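import Literature.NumberTheory.LFunctions.LogDerivAtOneExplicitZeroSumsProofs
import HarnessLib

/-!
# Táfula 2025, Theorem (complex and real characters) — PROVED
# (discharge of `tafula2025_theorem_complex` and `tafula2025_theorem_real`)

Topic `Literature/NumberTheory/LFunctions` (namespace `Literature.NumberTheory.LFunctions`, paper
vocabulary in `Tafula2025`); the PROOFS companion of `LogDerivAtOneQuasiZeroFree.lean` (statements,
row r6-T12 / HARVEST T-171 of the cell `landau-siegel`, §C). Everything here is PROVED; no
definitions, no named facts. **RH-free, GRH-free, abc-free.**

Main results:
* `tafula2025_theorem_complex_holds : tafula2025_theorem_complex` — for every admissible depth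
  function `f` (`2 ≤ f(q) ≤ C log q`) there are `K, q₀` (here `K = 9/2 + 5√C`, `q₀ = e⁷`) such that
  for `q ≥ q₀` and every COMPLEX primitive `χ` mod `q` whose `L`-function is quasi zero-free in the box
  `𝒬(q, f)`, `|Re(L'(1, χ)/L(1, χ))| ≤ K √(f(q) log q)`;
* `tafula2025_theorem_real_holds : tafula2025_theorem_real` — the same for REAL primitive `χ`
  (`K = 13/2 + 6√C`), with `L'/L(1, χ)` replaced by `L'/L(1, χ) − 1/(1 − β)`, `β` the largest real zero.

Both are now consequences of the tree's ENGINE THEOREM for Táfula's 2021 Proposition 3.2,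
`Tafula2021.abs_re_logDeriv_sub_pageBox_lt` (ls-lit-r6, `LogDerivAtOneExplicitZeroSumsProofs.lean`):
for every primitive `χ` mod `q ≥ 2`, every `F ≥ 2` and `𝒮 = Z(χ) ∩ ℬ_F` (`ℬ_F` the Page box
`{σ > 1 − 1/F, |t| < 1/√F}`),
`|Re(L'/L(1, χ) − Σ_{ρ∈𝒮} m(ρ)/(1 − ρ))| < (7/2 + 2Σ_𝒮 m)√(F log q) + 5F + 1`.

## The printed proof and its transport (READ: arXiv:2001.02405 §1 eq. (∗) and the Theorem,
## p0003:L9–L20; §2 «Proof of the theorem», Lemmas 2.1–2.4 and the final display, p0005:L1–p0006:L74;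
## and the 2021 engine, arXiv:1911.07215 §3.2 proof of Proposition 3.2, p0007:L95–L105)

The 2025 paper proves its Theorem by the pairing-function method (§2: Lemma 2.1 = the explicit
formula at `1 + ε` with `|ζ'/ζ(1+ε)| < 1/ε`; Lemmas 2.2–2.4 = `|Π₀ − Π_{ε(q)}| ≪ √(f/log q)·Π_{ε(q)}`
off `𝒬 ∪ (1 − 𝒬)` with `ε(q) = 2/√(f(q) log q)`; final display p0006:L64–L74:
`|Re L'/L(1,χ) − Σ_{ρ∈𝒬} Re(…)| ≪ √(f log q) + f`, «Hence, since `f(q) ≪ log q` (by hypothesis), the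
claim of the theorem follows»). The tree already holds this computation WITH EXPLICIT CONSTANTS as the
engine of the 2021 paper's Proposition 3.2 (`Tafula2021.abs_re_logDeriv_sub_pageBox_lt`, every
`M ≥ 2`: `(7/2 + 2|Z(χ) ∩ ℬ_M|)√(M log q) + 5M + 1`), whose box is the Page box
`ℬ_M = {σ > 1 − 1/M, |t| < 1/√M}` instead of `𝒬`. We therefore do NOT re-run the pairing argument
(deviation from the printed proof: same method, the 2021 constants; nothing of §2 is retyped) and
argue as follows, with `M := f(q)`:
* `𝒬(q, f) = {σ > 1 − 1/f(q), |t| < 1 − 1/√(f(q) log q)}` CONTAINS `ℬ_{f(q)}` as soon as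
  `1/√f + 1/√(f log q) ≤ 1`, which holds for `f ≥ 2`, `log q ≥ 7` (`1/√2 + 1/√14 ≤ 1/1.41 + 1/3.7 < 1`;
  `pageBox_subset_box`), so «quasi zero-free in `𝒬`» controls `Z(χ) ∩ ℬ_{f(q)}`;
* COMPLEX `χ` (`χ² ≠ 1`): no zero in `𝒬`, hence none in `ℬ_f`: `𝒮 = ∅` and the engine gives
  `|Re L'/L(1, χ)| < (7/2)√(f log q) + 5f + 1 ≤ (9/2 + 5√C)√(f log q)`
  (`2 ≤ f ≤ C log q ⇒ f ≤ √C·√(f log q)` and `1 ≤ √(f log q)`; `size_of_admissible`);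
* REAL `χ` (`χ² = 1`): at most one zero in `𝒬`, real and simple. If the largest real zero `β` has
  `β > 1 − 1/f(q)` then `β ∈ ℬ_f`, `𝒮 = {β}` with `m(β) = 1` (`analyticOrderAt = 1` at a simple zero,
  Mathlib `AnalyticAt.analyticOrderAt_eq_one_of_zero_deriv_ne_zero`) and the engine bounds
  `|Re(L'/L(1, χ) − 1/(1 − β))|` by `(11/2)√(f log q) + 5f + 1`; otherwise `𝒮 = ∅` (a zero in
  `ℬ_f ⊆ 𝒬` would be a REAL zero in `(β, 1)`), the engine bounds `|Re L'/L(1, χ)|`, and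
  `0 < 1/(1 − β) ≤ f(q) ≤ √C √(f log q)` is absorbed (this is the source's remark that trivial /
  far real zeros are harmless, §3.2 p0007:L32–L34). For a real character `L'/L(1, χ)` is real
  (`χ̄ = χ`, `L'/L(conj s, χ) = conj L'/L(s, χ̄)`: `DirichletTheta.logDeriv_LFunction_conj`), so the
  norm in the statement is the absolute value of the real part (`im_logDeriv_one_eq_zero`).
The constants `K` (`9/2 + 5√C`, `13/2 + 6√C`) and `q₀ = e⁷` are explicit here but existential in the
facts as typed («`= O(√(f(q) log q))`, `q → +∞`»).

## References
* C. Táfula, *Zeros near `s = 1` and the constant term of `L'/L` for `L`-functions in the Selberg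
  class*, Indag. Math. (N.S.) **36** (2025) 979–987, doi:10.1016/j.indag.2024.11.003 = arXiv:2001.02405
  (Dirichlet case, the held text), §1 Theorem and §2. [Tafula2025]
* C. Táfula, *On Landau–Siegel zeros and heights of singular moduli*, Acta Arith. **201** (2021),
  1–28 = arXiv:1911.07215, Proposition 3.2. [Tafula2021]
* H. L. Montgomery, R. C. Vaughan, *Multiplicative Number Theory I*, §10.1. [MontgomeryVaughan2007]

LABEL (cell rule): literature layer, sub-cell §C of the cell `landau-siegel` (typer pool, seat
ls-lit-typer-2; WORD ls-lit-lead 2026-08-27T01:30:41Z), proof-only (0 new facts, net debt −2).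
«The programme SEARCHES and TYPES; no claim about Landau–Siegel zeros, Theorems 1–2 of
arXiv:2211.02515 or a repaired Margin232 until a kernel theorem says so.»
-/

noncomputable section

open Complex Finset
open scoped ComplexConjugate

namespace Literature.NumberTheory.LFunctions

namespace Tafula2025

open Tafula2021 DirichletDisc

/-! ### Elementary inputs: the modulus range, the box inclusion, the size of `f(q)` -/

/-- A primitive character modulo `q ≥ 2` is not principal. [folklore] -/
private theorem ne_one_of_isPrimitive {q : ℕ} [NeZero q] (hq : 2 ≤ q) {χ : DirichletCharacter ℂ q}
    (hχ : χ.IsPrimitive) : χ ≠ 1 := by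
  intro h1
  have hc := (DirichletCharacter.isPrimitive_def χ).mp hχ
  rw [h1, DirichletCharacter.conductor_one] at hc
  omega

/-- `q ≥ e⁷` gives `log q ≥ 7` and `q ≥ 2`. [folklore] -/
private theorem seven_le_log {q : ℕ} (hq : Real.exp 7 ≤ (q : ℝ)) : 7 ≤ Real.log q ∧ 2 ≤ q := by
  have hqpos : (0 : ℝ) < q := lt_of_lt_of_le (Real.exp_pos 7) hq
  refine ⟨by rw [Real.le_log_iff_exp_le hqpos]; exact hq, ?_⟩
  have h8 : (8 : ℝ) ≤ Real.exp 7 := by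
    have := Real.add_one_le_exp (7 : ℝ); norm_num at this ⊢; linarith
  exact_mod_cast (show (2 : ℝ) ≤ q by linarith)

/-- **The Page box sits inside the 2025 box for large `q`**: `ℬ_{f(q)} ⊆ 𝒬(q, f)` whenever
`f(q) ≥ 2` and `log q ≥ 7`, because `1/√f + 1/√(f log q) ≤ 1/√2 + 1/√14 < 1`.
[cite: Tafula2025, §1 eq. (∗) (arXiv p0003:L11–L13)] [cite: Tafula2021, Proposition 3.2 (arXiv p0006:L9–L11)] -/
theorem pageBox_subset_box {q : ℕ} {f : ℕ → ℝ} (hf2 : 2 ≤ f q) (hL : 7 ≤ Real.log q) :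
    pageBox (f q) ⊆ box q f := by
  intro s hs
  refine ⟨hs.1, lt_of_lt_of_le hs.2 ?_⟩
  have hfpos : 0 < f q := by linarith
  have ha : 1 / Real.sqrt (f q) ≤ 1 / 1.41 := by
    apply one_div_le_one_div_of_le (by norm_num)
    rw [show (1.41 : ℝ) = Real.sqrt (1.41 ^ 2) by rw [Real.sqrt_sq (by norm_num)]]
    exact Real.sqrt_le_sqrt (by nlinarith)
  have hb : 1 / Real.sqrt (f q * Real.log q) ≤ 1 / 3.7 := by
    apply one_div_le_one_div_of_le (by norm_num)
    rw [show (3.7 : ℝ) = Real.sqrt (3.7 ^ 2) by rw [Real.sqrt_sq (by norm_num)]]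
    exact Real.sqrt_le_sqrt (by nlinarith)
  norm_num at ha hb ⊢
  linarith

/-- From `2 ≤ f(q) ≤ C log q` (`q ≥ 2`): `0 < C`, `f(q) ≤ √C · √(f(q) log q)` and `1 ≤ √(f(q) log q)`.
[cite: Tafula2025, §1 (arXiv p0003:L13)] -/
private theorem size_of_admissible {q : ℕ} {f : ℕ → ℝ} {C : ℝ} (hL : 7 ≤ Real.log q)
    (hf2 : 2 ≤ f q) (hfC : f q ≤ C * Real.log q) :
    0 < C ∧ f q ≤ Real.sqrt C * Real.sqrt (f q * Real.log q) ∧ 1 ≤ Real.sqrt (f q * Real.log q) := by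
  have hLpos : 0 < Real.log q := by linarith
  have hC : 0 < C := by
    by_contra h
    rw [not_lt] at h
    have : C * Real.log q ≤ 0 := mul_nonpos_of_nonpos_of_nonneg h hLpos.le
    linarith
  refine ⟨hC, ?_, ?_⟩
  · have hf0 : 0 ≤ f q := by linarith
    calc f q = Real.sqrt (f q * f q) := (Real.sqrt_mul_self hf0).symm
      _ ≤ Real.sqrt (C * (f q * Real.log q)) := Real.sqrt_le_sqrt (by nlinarith)
      _ = Real.sqrt C * Real.sqrt (f q * Real.log q) := Real.sqrt_mul hC.le _
  · calc (1 : ℝ) = Real.sqrt 1 := Real.sqrt_one.symm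
      _ ≤ Real.sqrt (f q * Real.log q) := Real.sqrt_le_sqrt (by nlinarith)

/-- **`L'/L(1, χ)` is real for a real character** (`χ² = 1`, `χ ≠ χ₀`): `χ̄ = χ` and
`L'/L(conj s, χ) = conj L'/L(s, χ̄)`. [cite: MontgomeryVaughan2007, §10.1 p. 334] -/
theorem im_logDeriv_one_eq_zero {q : ℕ} [NeZero q] {χ : DirichletCharacter ℂ q} (h1 : χ ≠ 1)
    (hχ2 : χ ^ 2 = 1) : (deriv χ.LFunction 1 / χ.LFunction 1).im = 0 := by
  have hinv : χ⁻¹ = χ := inv_eq_of_mul_eq_one_right (by rw [← pow_two, hχ2])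
  have h := DirichletTheta.logDeriv_LFunction_conj (χ := χ) h1 1
  rw [map_one, hinv, logDeriv_apply] at h
  exact Complex.conj_eq_iff_im.1 h.symm

/-- A zero of `L(s, χ)` (`χ ≠ χ₀`) has `Re s < 1`. [folklore] -/
private theorem re_lt_one_of_zero' {q : ℕ} [NeZero q] (χ : DirichletCharacter ℂ q)
    (hχ : χ ≠ 1) {s : ℂ} (hz : χ.LFunction s = 0) : s.re < 1 := by
  by_contra h
  rw [not_lt] at h
  exact DirichletCharacter.LFunction_ne_zero_of_one_le_re χ (Or.inl hχ) h hz

/-! ### The complex-character theorem -/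

/-- **Táfula 2025, Theorem — complex characters — PROVED** (discharge of the named fact
`Literature.NumberTheory.LFunctions.tafula2025_theorem_complex`, with `K = 9/2 + 5√C`, `q₀ = e⁷`):
quasi zero-free in `𝒬(q, f) ⊇ ℬ_{f(q)}` and `χ² ≠ 1` give `Z(χ) ∩ ℬ_{f(q)} = ∅`, and the engine
`Tafula2021.abs_re_logDeriv_sub_pageBox_lt` with `F = f(q)`, `𝒮 = ∅` gives
`|Re L'/L(1, χ)| < (7/2)√(f log q) + 5f + 1 ≤ (9/2 + 5√C)√(f log q)`.
[cite: Tafula2025, Theorem (§1; arXiv:2001.02405 p0003:L15–L18)] [cite: Tafula2021, Proposition 3.2 and its proof (arXiv p0007:L95–L105)] -/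
theorem _root_.Literature.NumberTheory.LFunctions.tafula2025_theorem_complex_holds :
    tafula2025_theorem_complex := by
  intro f C hf
  refine ⟨9 / 2 + 5 * Real.sqrt C, Real.exp 7, ?_⟩
  intro q _ hq χ hχ hχ2 hQ
  obtain ⟨hL, hq2⟩ := seven_le_log hq
  obtain ⟨hf2, hfC⟩ := hf q hq2
  have h1 : χ ≠ 1 := ne_one_of_isPrimitive hq2 hχ
  obtain ⟨hC, hfle, hr1⟩ := size_of_admissible hL hf2 hfC
  -- no zero of `L(s, χ)` in the Page box `ℬ_{f(q)} ⊆ 𝒬(q, f)`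
  have hS : ∀ ρ : ℂ, ρ ∈ (∅ : Finset ℂ) ↔ ρ ∈ pageBox (f q) ∧ 0 < zeroOrder χ ρ := by
    intro ρ
    simp only [Finset.notMem_empty, false_iff, not_and, not_lt, Nat.le_zero]
    intro hρ
    have hne : χ.LFunction ρ ≠ 0 := hQ.1 hχ2 ρ (pageBox_subset_box hf2 hL hρ)
    by_contra hm
    exact hne ((zeroOrder_pos_iff χ h1 ρ).1 (Nat.pos_of_ne_zero hm))
  have h := abs_re_logDeriv_sub_pageBox_lt hq2 χ hχ hf2 ∅ hS
  simp only [Finset.sum_empty, sub_zero, mul_zero, add_zero] at h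
  -- `5f + 1 ≤ (5√C + 1)√(f log q)`
  set r : ℝ := Real.sqrt (f q * Real.log q) with hr
  have h5 : 5 * f q + 1 ≤ (5 * Real.sqrt C + 1) * r := by nlinarith [Real.sqrt_nonneg C]
  have hCr : 0 ≤ Real.sqrt C * r := mul_nonneg (Real.sqrt_nonneg C) (by linarith)
  have : 7 / 2 * r + 5 * f q + 1 ≤ (9 / 2 + 5 * Real.sqrt C) * r := by nlinarith
  exact h.le.trans this

/-! ### The real-character theorem -/

/-- **Táfula 2025, Theorem — real characters — PROVED** (discharge of the named fact
`Literature.NumberTheory.LFunctions.tafula2025_theorem_real`, with `K = 13/2 + 6√C`, `q₀ = e⁷`):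
for `χ² = 1` quasi zero-free in `𝒬(q, f) ⊇ ℬ_{f(q)}` and `β` the largest real zero, either
`β > 1 − 1/f(q)`, `Z(χ) ∩ ℬ_f = {β}` with `m(β) = 1` and the engine bounds
`|Re(L'/L(1, χ) − 1/(1 − β))| < (11/2)√(f log q) + 5f + 1`, or `β ≤ 1 − 1/f(q)`, `Z(χ) ∩ ℬ_f = ∅`
(a zero there would be a real zero in `(β, 1)`), the engine bounds `|Re L'/L(1, χ)|` and
`0 < 1/(1 − β) ≤ f(q)`; finally `L'/L(1, χ) − 1/(1 − β)` is real, so its norm is `|Re|`.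
[cite: Tafula2025, Theorem (§1; arXiv:2001.02405 p0003:L18–L20)] [cite: Tafula2021, Proposition 3.2 and its proof (arXiv p0007:L95–L105)] -/
theorem _root_.Literature.NumberTheory.LFunctions.tafula2025_theorem_real_holds :
    tafula2025_theorem_real := by
  intro f C hf
  refine ⟨13 / 2 + 6 * Real.sqrt C, Real.exp 7, ?_⟩
  intro q _ hq χ hχ hχ2 hQ β hβ hno
  obtain ⟨hL, hq2⟩ := seven_le_log hq
  obtain ⟨hf2, hfC⟩ := hf q hq2
  have hfpos : 0 < f q := by linarith
  have h1 : χ ≠ 1 := ne_one_of_isPrimitive hq2 hχ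
  obtain ⟨hC, hfle, hr1⟩ := size_of_admissible hL hf2 hfC
  have hsub := pageBox_subset_box (q := q) (f := f) hf2 hL
  -- `β < 1`
  have hβ1 : β < 1 := by
    have := re_lt_one_of_zero' χ h1 hβ
    simpa using this
  -- the quantity is real: its norm is the absolute value of its real part
  set z : ℂ := deriv χ.LFunction 1 / χ.LFunction 1 - 1 / (1 - (β : ℂ)) with hz
  have ecast : (1 : ℂ) / (1 - (β : ℂ)) = ((1 / (1 - β) : ℝ) : ℂ) := by push_cast; rfl
  have hzim : z.im = 0 := by
    rw [hz, sub_im, im_logDeriv_one_eq_zero h1 hχ2, ecast, ofReal_im, sub_zero]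
  have hzre : z.re = (deriv χ.LFunction 1 / χ.LFunction 1).re - 1 / (1 - β) := by
    rw [hz, sub_re, ecast, ofReal_re]
  have hnorm : ‖z‖ = |z.re| := by
    rw [← Complex.re_add_im z, hzim]
    simp
  rw [hnorm, hzre]
  set r : ℝ := Real.sqrt (f q * Real.log q) with hr
  by_cases hβbox : 1 - 1 / f q < β
  · -- Case 1: `β` in the Page box; `𝒮 = {β}`, `m(β) = 1`
    have hβmem : (β : ℂ) ∈ pageBox (f q) := by
      refine ⟨by simpa using hβbox, ?_⟩
      simp only [ofReal_im, abs_zero]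
      positivity
    have hβbox' : (β : ℂ) ∈ box q f := hsub hβmem
    obtain ⟨-, hderiv, huniq⟩ := hQ.2 hχ2 (β : ℂ) hβbox' hβ
    have hmβ : zeroOrder χ β = 1 := by
      have han : AnalyticAt ℂ χ.LFunction (β : ℂ) :=
        (DirichletCharacter.differentiable_LFunction h1).analyticAt _
      have h := han.analyticOrderAt_eq_one_of_zero_deriv_ne_zero hβ hderiv
      unfold DirichletDisc.zeroOrder analyticOrderNatAt
      rw [h]; rfl
    have hS : ∀ ρ : ℂ, ρ ∈ ({(β : ℂ)} : Finset ℂ) ↔ ρ ∈ pageBox (f q) ∧ 0 < zeroOrder χ ρ := by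
      intro ρ
      rw [Finset.mem_singleton]
      constructor
      · rintro rfl
        exact ⟨hβmem, by rw [hmβ]; exact one_pos⟩
      · rintro ⟨hρ, hm⟩
        exact huniq ρ (hsub hρ) ((zeroOrder_pos_iff χ h1 ρ).1 hm)
    have h := abs_re_logDeriv_sub_pageBox_lt hq2 χ hχ hf2 {(β : ℂ)} hS
    simp only [Finset.sum_singleton, hmβ, Nat.cast_one, one_mul, mul_one] at h
    rw [sub_re, ecast, ofReal_re, ← hr] at h
    -- `(7/2 + 2) r + 5f + 1 ≤ (13/2 + 6√C) r`
    have h5 : 5 * f q + 1 ≤ (5 * Real.sqrt C + 1) * r := by nlinarith [Real.sqrt_nonneg C]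
    have hCr : 0 ≤ Real.sqrt C * r := mul_nonneg (Real.sqrt_nonneg C) (by linarith)
    have : (7 / 2 + 2) * r + 5 * f q + 1 ≤ (13 / 2 + 6 * Real.sqrt C) * r := by nlinarith
    exact h.le.trans this
  · -- Case 2: `β ≤ 1 − 1/f(q)`; `𝒮 = ∅`
    rw [not_lt] at hβbox
    have hS : ∀ ρ : ℂ, ρ ∈ (∅ : Finset ℂ) ↔ ρ ∈ pageBox (f q) ∧ 0 < zeroOrder χ ρ := by
      intro ρ
      simp only [Finset.notMem_empty, false_iff, not_and, not_lt, Nat.le_zero]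
      intro hρ
      by_contra hm
      have hLρ : χ.LFunction ρ = 0 := (zeroOrder_pos_iff χ h1 ρ).1 (Nat.pos_of_ne_zero hm)
      obtain ⟨him0, -, -⟩ := hQ.2 hχ2 ρ (hsub hρ) hLρ
      have hρeq : ((ρ.re : ℝ) : ℂ) = ρ := Complex.ext (by simp) (by simp [him0])
      have hgt : β < ρ.re := lt_of_le_of_lt hβbox hρ.1
      have hlt : ρ.re < 1 := re_lt_one_of_zero' χ h1 hLρ
      exact hno ρ.re hgt hlt (by rw [hρeq]; exact hLρ)
    have h := abs_re_logDeriv_sub_pageBox_lt hq2 χ hχ hf2 ∅ hS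
    simp only [Finset.sum_empty, sub_zero, mul_zero, add_zero] at h
    rw [← hr] at h
    -- `0 < 1/(1 − β) ≤ f(q) ≤ √C r`
    have h1β : 1 / f q ≤ 1 - β := by linarith
    have hinv0 : 0 < 1 / (1 - β) := by
      have : 0 < 1 - β := by linarith
      positivity
    have hinv : 1 / (1 - β) ≤ f q := by
      rw [div_le_iff₀ (by linarith : 0 < 1 - β)]
      calc (1 : ℝ) = 1 / f q * f q := by field_simp
        _ ≤ (1 - β) * f q := mul_le_mul_of_nonneg_right h1β hfpos.le
        _ = f q * (1 - β) := by ring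
    have h5 : 5 * f q + 1 ≤ (5 * Real.sqrt C + 1) * r := by nlinarith [Real.sqrt_nonneg C]
    have hab : |(deriv χ.LFunction 1 / χ.LFunction 1).re - 1 / (1 - β)| ≤
        |(deriv χ.LFunction 1 / χ.LFunction 1).re| + 1 / (1 - β) := by
      calc |(deriv χ.LFunction 1 / χ.LFunction 1).re - 1 / (1 - β)|
          ≤ |(deriv χ.LFunction 1 / χ.LFunction 1).re| + |1 / (1 - β)| := abs_sub _ _
        _ = _ := by rw [abs_of_pos hinv0]
    have hCr : 0 ≤ Real.sqrt C * r := mul_nonneg (Real.sqrt_nonneg C) (by linarith)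
    have : 7 / 2 * r + 5 * f q + 1 + f q ≤ (13 / 2 + 6 * Real.sqrt C) * r := by
      nlinarith [Real.sqrt_nonneg C]
    linarith [h.le]

end Tafula2025

end Literature.NumberTheory.LFunctions

end
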